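/-
Copyright: harness tree, Literature layer (sorry-free). b2b-lace carver-g43 (CARVER gen 43), D10-KERNEL census v7,
node KU-SEP, leaf KU-SEP-INEQ-K: a rational interval-arithmetic kernel deciding the cell check of
`SrwTrigMajorantCells.abs_le_of_cellCheck` (Part A, d-free, literal-free) and one kernel-decided instance (Part B).
What-if / input-certification lane.
-/
import Literature.Probability.FitznerVanDerHofstad2017.SrwIntegralV
import HarnessLib

/-!
# A kernel-decidable cell check for bounded trigonometric majorants of `|t|` (what-if / input-certification lane)

Companion of `SrwTrigMajorant` (the separable majorant reduction of the symmetrised SRW integrals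
`K_{n,l}(x; d)`, `U_n(x; d)` of [FvdH17, Def. 2.4 (2.14)–(2.15)]) and of `SrwTrigMajorantCells` (the uniform-cell
soundness lemma `abs_le_of_cellCheck`: `N` cells of `[0,1]`, a certified lower value `gLo i ≤ g(xᵢ)` and slope
bound `|g'(xᵢ) - 1| ≤ dAbs i` per cell centre `xᵢ = (2i+1)h`, `h = 1/(2N)`, a curvature bound `M₂`, and the
inequalities `0 ≤ gLo i - xᵢ - h (dAbs i + M₂ h)` imply `|t| ≤ g(t) = B + c t² + Σ_r a_r cos(b_r t)` on `[-1,1]`).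
This file supplies the TOOL that produces those per-cell hypotheses from rational data and lets the kernel
decide them (`decide` on `ℚ`, in the style of `SrwSeedCertKernelD`):

* `Encl` — closed intervals with rational endpoints, with `add / sub / mul / scale / roundOut` and their
  membership lemmas (`Encl.mem_mul` is the four-corner product rule; `Encl.mem_roundOut` rounds outward to a
  fixed denominator so that numerators stay small);
* `Encl.cosSmall / sinSmall` — Taylor brackets for `cos t`, `sin t`, `|t| ≤ 1` (Mathlib `Real.cos_bound`,
  `Real.sin_bound`), and `Encl.dbl` — `K` doublings (`cos 2a = cos²a - sin²a`, `sin 2a = 2 sin a cos a`), so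
  that an angle `φ` is enclosed via `t = φ / 2^K`;
* `Encl.orbit` — the angle-addition recurrence `cos / sin (a + iθ)` with outward rounding at each step;
* `MajCert` — the rational data `(R, B, c, a_r, b_r, N, K, den, M2up)` of one majorant, the derived tables
  `gLo i`, `dLo i ≤ g'(xᵢ) - 1 ≤ dHi i`, `dAbs i`, `M2`, the `Bool` check `MajCert.check`, and the SOUNDNESS
  theorem `MajCert.sound`: `check = true` implies, for the explicit real function
  `g t = B + c t² + Σ_{r<R} a_r cos(b_r t)` and its derivative expression, exactly the hypotheses `hg`, `hd`,
  `hM`, `hcheck` of `SrwTrigMajorantCells.abs_le_of_cellCheck` (with `gLo`, `dAbs` the casts of the tables).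

Part B is ONE kernel-decided instance (`MajCert.gset`, `gset_check : gset.check = true` by `decide +kernel`,
`gset_sound`): the global coefficient set of the K/U separable-majorant device (literal rationals on the
`t`-scale).  The composition with `abs_le_of_cellCheck` / `srwK_le_of_trigMajorant` is a separate glue module
(it needs both companions built); this file imports neither companion and mentions no dimension and no value
of a lace-expansion quantity.  Nothing here is a certificate of such a quantity; Part A is a reusable
real-analysis / interval-arithmetic device and Part B a closed real inequality package decided by the kernel.
[cite: FitznerVanDerHofstad2016NoBLE, §5.1.2 (5.11)–(5.16) pp. 1091–1092]
-/

set_option Elab.async false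

namespace Literature.Probability.FitznerVanDerHofstad2017.TrigEncl

open Finset

/-- A closed interval with rational endpoints (no invariant `lo ≤ hi` is stored; an empty interval simply
has no members).
[cite: FitznerVanDerHofstad2016NoBLE, §5.1.2 (5.11)–(5.16) pp. 1091–1092] -/
structure Encl where
  /-- lower endpoint -/
  lo : ℚ
  /-- upper endpoint -/
  hi : ℚ

namespace Encl

/-- Membership of a real number in the interval.
[cite: FitznerVanDerHofstad2016NoBLE, §5.1.2 (5.11)–(5.16) pp. 1091–1092] -/
def mem (I : Encl) (x : ℝ) : Prop := (I.lo : ℝ) ≤ x ∧ x ≤ (I.hi : ℝ)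

/-- The point interval `[q, q]`.
[cite: FitznerVanDerHofstad2016NoBLE, §5.1.2 (5.11)–(5.16) pp. 1091–1092] -/
def const (q : ℚ) : Encl := ⟨q, q⟩

/-- Interval sum.
[cite: FitznerVanDerHofstad2016NoBLE, §5.1.2 (5.11)–(5.16) pp. 1091–1092] -/
def add (I J : Encl) : Encl := ⟨I.lo + J.lo, I.hi + J.hi⟩

/-- Interval difference.
[cite: FitznerVanDerHofstad2016NoBLE, §5.1.2 (5.11)–(5.16) pp. 1091–1092] -/
def sub (I J : Encl) : Encl := ⟨I.lo - J.hi, I.hi - J.lo⟩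

/-- Interval product (four-corner rule).
[cite: FitznerVanDerHofstad2016NoBLE, §5.1.2 (5.11)–(5.16) pp. 1091–1092] -/
def mul (I J : Encl) : Encl :=
  ⟨min (min (I.lo * J.lo) (I.lo * J.hi)) (min (I.hi * J.lo) (I.hi * J.hi)),
   max (max (I.lo * J.lo) (I.lo * J.hi)) (max (I.hi * J.lo) (I.hi * J.hi))⟩

/-- Multiplication by a rational constant (either sign).
[cite: FitznerVanDerHofstad2016NoBLE, §5.1.2 (5.11)–(5.16) pp. 1091–1092] -/
def scale (I : Encl) (q : ℚ) : Encl := ⟨min (q * I.lo) (q * I.hi), max (q * I.lo) (q * I.hi)⟩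

/-- Outward rounding of both endpoints to the grid `(1/den) ℤ`.
[cite: FitznerVanDerHofstad2016NoBLE, §5.1.2 (5.11)–(5.16) pp. 1091–1092] -/
def roundOut (I : Encl) (den : ℕ) : Encl :=
  ⟨((⌊I.lo * den⌋ : ℤ) : ℚ) / den, ((⌈I.hi * den⌉ : ℤ) : ℚ) / den⟩

/-- The point interval contains its point. [cite: FitznerVanDerHofstad2016NoBLE, §5.1.2 (5.11)–(5.16) pp. 1091–1092] -/
theorem mem_const (q : ℚ) : (const q).mem (q : ℝ) := ⟨le_rfl, le_rfl⟩

/-- Soundness of interval addition. [cite: FitznerVanDerHofstad2016NoBLE, §5.1.2 (5.11)–(5.16) pp. 1091–1092] -/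
theorem mem_add {I J : Encl} {x y : ℝ} (hx : I.mem x) (hy : J.mem y) : (I.add J).mem (x + y) := by
  rcases hx with ⟨h1, h2⟩
  rcases hy with ⟨h3, h4⟩
  refine ⟨?_, ?_⟩
  · show ((I.lo + J.lo : ℚ) : ℝ) ≤ x + y
    push_cast; linarith
  · show x + y ≤ ((I.hi + J.hi : ℚ) : ℝ)
    push_cast; linarith

/-- Soundness of interval subtraction. [cite: FitznerVanDerHofstad2016NoBLE, §5.1.2 (5.11)–(5.16) pp. 1091–1092] -/
theorem mem_sub {I J : Encl} {x y : ℝ} (hx : I.mem x) (hy : J.mem y) : (I.sub J).mem (x - y) := by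
  rcases hx with ⟨h1, h2⟩
  rcases hy with ⟨h3, h4⟩
  refine ⟨?_, ?_⟩
  · show ((I.lo - J.hi : ℚ) : ℝ) ≤ x - y
    push_cast; linarith
  · show x - y ≤ ((I.hi - J.lo : ℚ) : ℝ)
    push_cast; linarith

/-- `x y` lies between `a y` and `b y` when `a ≤ x ≤ b` (either sign of `y`). [folklore] -/
private theorem mul_mem_left {a b x : ℝ} (hax : a ≤ x) (hxb : x ≤ b) (y : ℝ) :
    min (a * y) (b * y) ≤ x * y ∧ x * y ≤ max (a * y) (b * y) := by
  rcases le_total 0 y with hy | hy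
  · exact ⟨(min_le_left _ _).trans (mul_le_mul_of_nonneg_right hax hy),
      (mul_le_mul_of_nonneg_right hxb hy).trans (le_max_right _ _)⟩
  · exact ⟨(min_le_right _ _).trans (mul_le_mul_of_nonpos_right hxb hy),
      (mul_le_mul_of_nonpos_right hax hy).trans (le_max_left _ _)⟩

/-- `a y` lies between `a c` and `a d` when `c ≤ y ≤ d` (either sign of `a`). [folklore] -/
private theorem mul_mem_right {c d y : ℝ} (hcy : c ≤ y) (hyd : y ≤ d) (a : ℝ) :
    min (a * c) (a * d) ≤ a * y ∧ a * y ≤ max (a * c) (a * d) := by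
  rcases le_total 0 a with ha | ha
  · exact ⟨(min_le_left _ _).trans (mul_le_mul_of_nonneg_left hcy ha),
      (mul_le_mul_of_nonneg_left hyd ha).trans (le_max_right _ _)⟩
  · exact ⟨(min_le_right _ _).trans (mul_le_mul_of_nonpos_left hyd ha),
      (mul_le_mul_of_nonpos_left hcy ha).trans (le_max_left _ _)⟩

/-- Soundness of the four-corner interval product. [cite: FitznerVanDerHofstad2016NoBLE, §5.1.2 (5.11)–(5.16) pp.
1091–1092] -/
theorem mem_mul {I J : Encl} {x y : ℝ} (hx : I.mem x) (hy : J.mem y) : (I.mul J).mem (x * y) := by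
  rcases hx with ⟨h1, h2⟩
  rcases hy with ⟨h3, h4⟩
  have hxy := mul_mem_left h1 h2 y
  have hlo := mul_mem_right h3 h4 (I.lo : ℝ)
  have hhi := mul_mem_right h3 h4 (I.hi : ℝ)
  refine ⟨?_, ?_⟩
  · show ((min (min (I.lo * J.lo) (I.lo * J.hi)) (min (I.hi * J.lo) (I.hi * J.hi)) : ℚ) : ℝ) ≤ x * y
    push_cast
    exact (min_le_min hlo.1 hhi.1).trans hxy.1
  · show x * y ≤ ((max (max (I.lo * J.lo) (I.lo * J.hi)) (max (I.hi * J.lo) (I.hi * J.hi)) : ℚ) : ℝ)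
    push_cast
    exact hxy.2.trans (max_le_max hlo.2 hhi.2)

/-- Soundness of multiplication by a rational constant. [cite: FitznerVanDerHofstad2016NoBLE, §5.1.2 (5.11)–(5.16)
pp. 1091–1092] -/
theorem mem_scale {I : Encl} {x : ℝ} (hx : I.mem x) (q : ℚ) : (I.scale q).mem ((q : ℝ) * x) := by
  rcases hx with ⟨h1, h2⟩
  have h := mul_mem_right h1 h2 (q : ℝ)
  refine ⟨?_, ?_⟩
  · show ((min (q * I.lo) (q * I.hi) : ℚ) : ℝ) ≤ (q : ℝ) * x
    push_cast; exact h.1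
  · show (q : ℝ) * x ≤ ((max (q * I.lo) (q * I.hi) : ℚ) : ℝ)
    push_cast; exact h.2

/-- Soundness of outward rounding to the grid `(1/den) ℤ` (`Int.floor_le`, `Int.le_ceil`). [cite:
FitznerVanDerHofstad2016NoBLE, §5.1.2 (5.11)–(5.16) pp. 1091–1092] -/
theorem mem_roundOut {den : ℕ} (hden : 0 < den) {I : Encl} {x : ℝ} (hx : I.mem x) :
    (I.roundOut den).mem x := by
  rcases hx with ⟨h1, h2⟩
  have hd : (0 : ℚ) < den := by exact_mod_cast hden
  have hlo : ((⌊I.lo * den⌋ : ℤ) : ℚ) / den ≤ I.lo := by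
    rw [div_le_iff₀ hd]; exact Int.floor_le _
  have hhi : I.hi ≤ ((⌈I.hi * den⌉ : ℤ) : ℚ) / den := by
    rw [le_div_iff₀ hd]; exact Int.le_ceil _
  exact ⟨le_trans (Rat.cast_le.mpr hlo) h1, le_trans h2 (Rat.cast_le.mpr hhi)⟩

/-! ### Trigonometric enclosures -/

/-- Taylor bracket for `cos t`, `|t| ≤ 1` (`Real.cos_bound`).
[cite: FitznerVanDerHofstad2016NoBLE, §5.1.2 (5.11)–(5.16) pp. 1091–1092] -/
def cosSmall (t : ℚ) : Encl := ⟨1 - t ^ 2 / 2 - t ^ 4 * (5 / 96), 1 - t ^ 2 / 2 + t ^ 4 * (5 / 96)⟩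

/-- Taylor bracket for `sin t`, `|t| ≤ 1` (`Real.sin_bound`).
[cite: FitznerVanDerHofstad2016NoBLE, §5.1.2 (5.11)–(5.16) pp. 1091–1092] -/
def sinSmall (t : ℚ) : Encl := ⟨t - t ^ 3 / 6 - |t| ^ 5 / 100, t - t ^ 3 / 6 + |t| ^ 5 / 100⟩

/-- `cos t` lies in its Taylor bracket for `|t| ≤ 1` (`Real.cos_bound`). [cite: FitznerVanDerHofstad2016NoBLE,
§5.1.2 (5.11)–(5.16) pp. 1091–1092] -/
theorem mem_cosSmall {t : ℚ} (ht : |t| ≤ 1) : (cosSmall t).mem (Real.cos t) := by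
  have h := Real.cos_bound (x := (t : ℝ)) (by exact_mod_cast ht)
  have e : |(t : ℝ)| ^ 4 = (t : ℝ) ^ 4 := by
    rw [pow_abs]; exact abs_of_nonneg (by positivity)
  rw [e] at h
  rcases abs_le.1 h with ⟨h1, h2⟩
  refine ⟨?_, ?_⟩
  · show ((1 - t ^ 2 / 2 - t ^ 4 * (5 / 96) : ℚ) : ℝ) ≤ Real.cos t
    push_cast; linarith
  · show Real.cos t ≤ ((1 - t ^ 2 / 2 + t ^ 4 * (5 / 96) : ℚ) : ℝ)
    push_cast; linarith

/-- `sin t` lies in its Taylor bracket for `|t| ≤ 1` (`Real.sin_bound`). [cite: FitznerVanDerHofstad2016NoBLE,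
§5.1.2 (5.11)–(5.16) pp. 1091–1092] -/
theorem mem_sinSmall {t : ℚ} (ht : |t| ≤ 1) : (sinSmall t).mem (Real.sin t) := by
  have h := Real.sin_bound (x := (t : ℝ)) (by exact_mod_cast ht)
  rcases abs_le.1 h with ⟨h1, h2⟩
  refine ⟨?_, ?_⟩
  · show ((t - t ^ 3 / 6 - |t| ^ 5 / 100 : ℚ) : ℝ) ≤ Real.sin t
    push_cast; linarith
  · show Real.sin t ≤ ((t - t ^ 3 / 6 + |t| ^ 5 / 100 : ℚ) : ℝ)
    push_cast; linarith

/-- One angle doubling on a (cos, sin) pair of enclosures.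
[cite: FitznerVanDerHofstad2016NoBLE, §5.1.2 (5.11)–(5.16) pp. 1091–1092] -/
def double (p : Encl × Encl) : Encl × Encl :=
  ((p.1.mul p.1).sub (p.2.mul p.2), (p.2.mul p.1).scale 2)

/-- Soundness of one angle doubling (`cos 2a = cos a cos a - sin a sin a`, `sin 2a = 2 sin a cos a`). [cite:
FitznerVanDerHofstad2016NoBLE, §5.1.2 (5.11)–(5.16) pp. 1091–1092] -/
theorem mem_double {p : Encl × Encl} {a : ℝ} (h1 : p.1.mem (Real.cos a)) (h2 : p.2.mem (Real.sin a)) :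
    (double p).1.mem (Real.cos (2 * a)) ∧ (double p).2.mem (Real.sin (2 * a)) := by
  refine ⟨?_, ?_⟩
  · have e : Real.cos (2 * a) = Real.cos a * Real.cos a - Real.sin a * Real.sin a := by
      rw [two_mul, Real.cos_add]
    rw [e]
    exact mem_sub (mem_mul h1 h1) (mem_mul h2 h2)
  · have e : Real.sin (2 * a) = ((2 : ℚ) : ℝ) * (Real.sin a * Real.cos a) := by
      rw [Real.sin_two_mul]; push_cast; ring
    rw [e]
    exact mem_scale (mem_mul h2 h1) 2

/-- `K` doublings starting from the Taylor brackets at `t`: encloses `cos / sin (2^K t)`, with outward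
rounding to denominator `den` after each doubling.
[cite: FitznerVanDerHofstad2016NoBLE, §5.1.2 (5.11)–(5.16) pp. 1091–1092] -/
def dbl (den : ℕ) (t : ℚ) : ℕ → Encl × Encl
  | 0 => (cosSmall t, sinSmall t)
  | k + 1 => ((double (dbl den t k)).1.roundOut den, (double (dbl den t k)).2.roundOut den)

/-- Soundness of `K` doublings: `dbl den t K` encloses `(cos, sin)(2^K t)`. [cite: FitznerVanDerHofstad2016NoBLE,
§5.1.2 (5.11)–(5.16) pp. 1091–1092] -/
theorem mem_dbl {den : ℕ} (hden : 0 < den) {t : ℚ} (ht : |t| ≤ 1) :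
    ∀ k : ℕ, (dbl den t k).1.mem (Real.cos (2 ^ k * t)) ∧ (dbl den t k).2.mem (Real.sin (2 ^ k * t))
  | 0 => by simpa [dbl] using And.intro (mem_cosSmall ht) (mem_sinSmall ht)
  | k + 1 => by
      obtain ⟨h1, h2⟩ := mem_dbl hden ht k
      have hd := mem_double h1 h2
      have e : (2 : ℝ) ^ (k + 1) * t = 2 * (2 ^ k * t) := by ring
      rw [e]
      exact ⟨mem_roundOut hden hd.1, mem_roundOut hden hd.2⟩

/-- One angle-addition step: from enclosures of `(cos a, sin a)` and of `cos θ`, `sin θ` to enclosures of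
`(cos (a+θ), sin (a+θ))`.
[cite: FitznerVanDerHofstad2016NoBLE, §5.1.2 (5.11)–(5.16) pp. 1091–1092] -/
def rot (p : Encl × Encl) (c s : Encl) : Encl × Encl :=
  ((p.1.mul c).sub (p.2.mul s), (p.2.mul c).add (p.1.mul s))

/-- Soundness of one angle-addition step (`Real.cos_add`, `Real.sin_add`). [cite: FitznerVanDerHofstad2016NoBLE,
§5.1.2 (5.11)–(5.16) pp. 1091–1092] -/
theorem mem_rot {p : Encl × Encl} {c s : Encl} {a θ : ℝ} (h1 : p.1.mem (Real.cos a))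
    (h2 : p.2.mem (Real.sin a)) (hc : c.mem (Real.cos θ)) (hs : s.mem (Real.sin θ)) :
    (rot p c s).1.mem (Real.cos (a + θ)) ∧ (rot p c s).2.mem (Real.sin (a + θ)) := by
  rw [Real.cos_add, Real.sin_add]
  exact ⟨mem_sub (mem_mul h1 hc) (mem_mul h2 hs), mem_add (mem_mul h2 hc) (mem_mul h1 hs)⟩

/-- The orbit `cos / sin (a + i θ)`, `i = 0, 1, 2, …`, by angle addition with outward rounding.
[cite: FitznerVanDerHofstad2016NoBLE, §5.1.2 (5.11)–(5.16) pp. 1091–1092] -/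
def orbit (den : ℕ) (p0 : Encl × Encl) (c s : Encl) : ℕ → Encl × Encl
  | 0 => p0
  | i + 1 => ((rot (orbit den p0 c s i) c s).1.roundOut den, (rot (orbit den p0 c s i) c s).2.roundOut den)

/-- Soundness of the angle-addition orbit: step `i` encloses `(cos, sin)(a + i θ)`. [cite:
FitznerVanDerHofstad2016NoBLE, §5.1.2 (5.11)–(5.16) pp. 1091–1092] -/
theorem mem_orbit {den : ℕ} (hden : 0 < den) {p0 : Encl × Encl} {c s : Encl} {a θ : ℝ}
    (h1 : p0.1.mem (Real.cos a)) (h2 : p0.2.mem (Real.sin a)) (hc : c.mem (Real.cos θ))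
    (hs : s.mem (Real.sin θ)) :
    ∀ i : ℕ, (orbit den p0 c s i).1.mem (Real.cos (a + i * θ)) ∧
      (orbit den p0 c s i).2.mem (Real.sin (a + i * θ))
  | 0 => by simpa [orbit] using And.intro h1 h2
  | i + 1 => by
      obtain ⟨k1, k2⟩ := mem_orbit hden h1 h2 hc hs i
      have hr := mem_rot k1 k2 hc hs
      have e : a + ((i + 1 : ℕ) : ℝ) * θ = a + i * θ + θ := by push_cast; ring
      rw [e]
      exact ⟨mem_roundOut hden hr.1, mem_roundOut hden hr.2⟩

end Encl

/-! ### The certificate record and its kernel check -/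

/-- Rational data of one bounded trigonometric majorant `g(t) = B + c t² + Σ_{r<R} a_r cos(b_r t)` together
with the discretisation parameters of its cell check: `N` cells of `[0,1]`, `K` doublings for the angle
enclosures, outward-rounding denominator `den`, and a rational curvature bound `M2up`.
[cite: FitznerVanDerHofstad2016NoBLE, §5.1.2 (5.11)–(5.16) pp. 1091–1092] -/
structure MajCert where
  /-- number of cosine terms -/
  R : ℕ
  /-- constant coefficient -/
  B : ℚ
  /-- coefficient of `t²` -/
  c : ℚ
  /-- cosine coefficients `a_r`, `r < R` -/
  a : ℕ → ℚ
  /-- cosine frequencies `b_r`, `r < R` -/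
  b : ℕ → ℚ
  /-- number of cells of `[0,1]` -/
  N : ℕ
  /-- number of angle doublings -/
  K : ℕ
  /-- outward-rounding denominator -/
  den : ℕ
  /-- claimed curvature bound -/
  M2up : ℚ

namespace MajCert

variable (m : MajCert)

/-- Half cell width `h = 1/(2N)`.
[cite: FitznerVanDerHofstad2016NoBLE, §5.1.2 (5.11)–(5.16) pp. 1091–1092] -/
def h : ℚ := 1 / (2 * (m.N : ℚ))

/-- Cell centre `xᵢ = (2i+1) h`.
[cite: FitznerVanDerHofstad2016NoBLE, §5.1.2 (5.11)–(5.16) pp. 1091–1092] -/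
def x (i : ℕ) : ℚ := (2 * (i : ℚ) + 1) * m.h

/-- Enclosures of `cos / sin` of the step angle `2 h b_r`.
[cite: FitznerVanDerHofstad2016NoBLE, §5.1.2 (5.11)–(5.16) pp. 1091–1092] -/
def step (r : ℕ) : Encl × Encl := Encl.dbl m.den (2 * m.h * m.b r / 2 ^ m.K) m.K

/-- Enclosures of `cos / sin` of the start angle `h b_r = b_r x₀`.
[cite: FitznerVanDerHofstad2016NoBLE, §5.1.2 (5.11)–(5.16) pp. 1091–1092] -/
def start (r : ℕ) : Encl × Encl := Encl.dbl m.den (m.h * m.b r / 2 ^ m.K) m.K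

/-- The default (junk) pair used by `List.getD` beyond index `R`.
[cite: FitznerVanDerHofstad2016NoBLE, §5.1.2 (5.11)–(5.16) pp. 1091–1092] -/
def dflt : Encl × Encl := (⟨0, 0⟩, ⟨0, 0⟩)

/-- The enclosure pair of index `r` in a state.
[cite: FitznerVanDerHofstad2016NoBLE, §5.1.2 (5.11)–(5.16) pp. 1091–1092] -/
def eOf (st : List (Encl × Encl)) (r : ℕ) : Encl × Encl := st.getD r dflt

/-- Initial state: the enclosures of `(cos, sin)(b_r x₀)`, `r < R`.
[cite: FitznerVanDerHofstad2016NoBLE, §5.1.2 (5.11)–(5.16) pp. 1091–1092] -/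
def stInit : List (Encl × Encl) := (List.range m.R).map fun r => m.start r

/-- The step table: the enclosures of `(cos, sin)(2 h b_r)`, `r < R` (computed once).
[cite: FitznerVanDerHofstad2016NoBLE, §5.1.2 (5.11)–(5.16) pp. 1091–1092] -/
def steps : List (Encl × Encl) := (List.range m.R).map fun r => m.step r

/-- One angle-addition step of the whole state (cell `i` to cell `i+1`) against a step table `sp`, with
outward rounding.
[cite: FitznerVanDerHofstad2016NoBLE, §5.1.2 (5.11)–(5.16) pp. 1091–1092] -/
def stNext (sp st : List (Encl × Encl)) : List (Encl × Encl) :=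
  (List.range m.R).map fun r =>
    ((Encl.rot (eOf st r) (eOf sp r).1 (eOf sp r).2).1.roundOut m.den,
     (Encl.rot (eOf st r) (eOf sp r).1 (eOf sp r).2).2.roundOut m.den)

/-- The state at cell `i`: enclosures of `(cos, sin)(b_r xᵢ)`, `r < R`.
[cite: FitznerVanDerHofstad2016NoBLE, §5.1.2 (5.11)–(5.16) pp. 1091–1092] -/
def stAt : ℕ → List (Encl × Encl)
  | 0 => m.stInit
  | i + 1 => m.stNext m.steps (stAt i)

section Tables

variable (e : ℕ → Encl × Encl)

/-- Certified lower value of `g(y)` from enclosures `e r` of `(cos, sin)(b_r y)`.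
[cite: FitznerVanDerHofstad2016NoBLE, §5.1.2 (5.11)–(5.16) pp. 1091–1092] -/
def gLoE (y : ℚ) : ℚ := m.B + m.c * y ^ 2 + ∑ r ∈ range m.R, ((e r).1.scale (m.a r)).lo

/-- Certified lower value of `g'(y) - 1 = 2 c y - Σ a_r b_r sin(b_r y) - 1`.
[cite: FitznerVanDerHofstad2016NoBLE, §5.1.2 (5.11)–(5.16) pp. 1091–1092] -/
def dLoE (y : ℚ) : ℚ := 2 * m.c * y - 1 - ∑ r ∈ range m.R, ((e r).2.scale (m.a r * m.b r)).hi

/-- Certified upper value of `g'(y) - 1`.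
[cite: FitznerVanDerHofstad2016NoBLE, §5.1.2 (5.11)–(5.16) pp. 1091–1092] -/
def dHiE (y : ℚ) : ℚ := 2 * m.c * y - 1 - ∑ r ∈ range m.R, ((e r).2.scale (m.a r * m.b r)).lo

/-- Certified bound on `|g'(y) - 1|`.
[cite: FitznerVanDerHofstad2016NoBLE, §5.1.2 (5.11)–(5.16) pp. 1091–1092] -/
def dAbsE (y : ℚ) : ℚ := max |m.dLoE e y| |m.dHiE e y|

/-- The cell inequality `0 ≤ gLo - y - h (dAbs + M2up h)` at centre `y`.
[cite: FitznerVanDerHofstad2016NoBLE, §5.1.2 (5.11)–(5.16) pp. 1091–1092] -/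
def cellOK (y : ℚ) : Bool := decide (0 ≤ m.gLoE e y - y - m.h * (m.dAbsE e y + m.M2up * m.h))

end Tables

/-- The curvature constant `2|c| + Σ |a_r| b_r²`.
[cite: FitznerVanDerHofstad2016NoBLE, §5.1.2 (5.11)–(5.16) pp. 1091–1092] -/
def M2 : ℚ := 2 * |m.c| + ∑ r ∈ range m.R, |m.a r| * m.b r ^ 2

/-- The cell loop: `loop n i st` checks cells `i, …, i+n-1` starting from state `st` (the state of cell `i`),
advancing the state by one angle-addition step per cell (linear in `N`).
[cite: FitznerVanDerHofstad2016NoBLE, §5.1.2 (5.11)–(5.16) pp. 1091–1092] -/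
def loop (sp : List (Encl × Encl)) : ℕ → ℕ → List (Encl × Encl) → Bool
  | 0, _, _ => true
  | n + 1, i, st => m.cellOK (eOf st) (m.x i) && loop sp n (i + 1) (m.stNext sp st)

/-- The kernel check: positivity of `N`, `den`, the curvature bound, the smallness of the reduced angles,
and the `N` cell inequalities.
[cite: FitznerVanDerHofstad2016NoBLE, §5.1.2 (5.11)–(5.16) pp. 1091–1092] -/
def check : Bool :=
  decide (0 < m.N) && decide (0 < m.den) && decide (m.M2 ≤ m.M2up) &&
  (List.range m.R).all (fun r =>
    decide (|2 * m.h * m.b r / 2 ^ m.K| ≤ 1) && decide (|m.h * m.b r / 2 ^ m.K| ≤ 1)) &&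
  m.loop m.steps m.N 0 m.stInit

/-- The certified lower value of `g(xᵢ)` (table entry).
[cite: FitznerVanDerHofstad2016NoBLE, §5.1.2 (5.11)–(5.16) pp. 1091–1092] -/
def gLo (i : ℕ) : ℚ := m.gLoE (eOf (m.stAt i)) (m.x i)

/-- The certified bound on `|g'(xᵢ) - 1|` (table entry).
[cite: FitznerVanDerHofstad2016NoBLE, §5.1.2 (5.11)–(5.16) pp. 1091–1092] -/
def dAbs (i : ℕ) : ℚ := m.dAbsE (eOf (m.stAt i)) (m.x i)

/-- The majorant as a real function.
[cite: FitznerVanDerHofstad2016NoBLE, §5.1.2 (5.11)–(5.16) pp. 1091–1092] -/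
noncomputable def g (t : ℝ) : ℝ :=
  m.B + m.c * t ^ 2 + ∑ r ∈ range m.R, (m.a r : ℝ) * Real.cos ((m.b r : ℝ) * t)

/-- The derivative expression of the majorant.
[cite: FitznerVanDerHofstad2016NoBLE, §5.1.2 (5.11)–(5.16) pp. 1091–1092] -/
noncomputable def g' (t : ℝ) : ℝ :=
  2 * m.c * t - ∑ r ∈ range m.R, (m.a r : ℝ) * m.b r * Real.sin ((m.b r : ℝ) * t)

/-- Soundness of the cell loop: if `loop steps n i (stAt i)` holds then every cell `i+j`, `j < n`, passes `cellOK`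
with the state `stAt (i+j)`. [cite: FitznerVanDerHofstad2016NoBLE, §5.1.2 (5.11)–(5.16) pp. 1091–1092] -/
theorem loop_sound : ∀ (n i : ℕ), m.loop m.steps n i (m.stAt i) = true →
    ∀ j, j < n → m.cellOK (eOf (m.stAt (i + j))) (m.x (i + j)) = true
  | 0, _, _, j, hj => absurd hj (Nat.not_lt_zero _)
  | n + 1, i, hl, j, hj => by
      simp only [loop, Bool.and_eq_true] at hl
      rcases j with _ | j
      · simpa using hl.1
      · have h2 : m.loop m.steps n (i + 1) (m.stAt (i + 1)) = true := hl.2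
        have := loop_sound n (i + 1) h2 j (by omega)
        have e : i + 1 + j = i + (j + 1) := by omega
        rw [e] at this
        exact this

/-- Indexing a state built by `List.map` over `List.range R`. [cite: FitznerVanDerHofstad2016NoBLE, §5.1.2
(5.11)–(5.16) pp. 1091–1092] -/
theorem eOf_map_range (f : ℕ → Encl × Encl) {r : ℕ} (hr : r < m.R) :
    eOf ((List.range m.R).map f) r = f r := by
  simp [eOf, dflt, List.getD_eq_getElem?_getD, List.getElem?_range hr]

/-- Entry `r` of the initial state is the start enclosure pair of index `r`. [cite: FitznerVanDerHofstad2016NoBLE,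
§5.1.2 (5.11)–(5.16) pp. 1091–1092] -/
theorem eOf_stInit {r : ℕ} (hr : r < m.R) : eOf m.stInit r = m.start r := by
  unfold stInit
  exact m.eOf_map_range _ hr

/-- Entry `r` of the step table is the step enclosure pair of index `r`. [cite: FitznerVanDerHofstad2016NoBLE,
§5.1.2 (5.11)–(5.16) pp. 1091–1092] -/
theorem eOf_steps {r : ℕ} (hr : r < m.R) : eOf m.steps r = m.step r := by
  unfold steps
  exact m.eOf_map_range _ hr

/-- Entry `r` of the advanced state is the rounded rotation of entry `r`. [cite: FitznerVanDerHofstad2016NoBLE,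
§5.1.2 (5.11)–(5.16) pp. 1091–1092] -/
theorem eOf_stNext' (st : List (Encl × Encl)) {r : ℕ} (hr : r < m.R) :
    eOf (m.stNext m.steps st) r =
      ((Encl.rot (eOf st r) (m.step r).1 (m.step r).2).1.roundOut m.den,
       (Encl.rot (eOf st r) (m.step r).1 (m.step r).2).2.roundOut m.den) := by
  unfold stNext
  rw [m.eOf_map_range _ hr, m.eOf_steps hr]

/-- The state at cell `i` encloses `(cos, sin)(b_r xᵢ)` for every `r < R` (induction on `i`: start angle `h b_r =
b_r x₀`, step angle `2 h b_r`). [cite: FitznerVanDerHofstad2016NoBLE, §5.1.2 (5.11)–(5.16) pp. 1091–1092] -/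
theorem mem_eOf_stAt (hden : 0 < m.den) {r : ℕ} (hr : r < m.R)
    (hr1 : |2 * m.h * m.b r / 2 ^ m.K| ≤ 1) (hr2 : |m.h * m.b r / 2 ^ m.K| ≤ 1) :
    ∀ i : ℕ, (eOf (m.stAt i) r).1.mem (Real.cos ((m.b r : ℝ) * m.x i)) ∧
      (eOf (m.stAt i) r).2.mem (Real.sin ((m.b r : ℝ) * m.x i))
  | 0 => by
      have ha := Encl.mem_dbl hden hr2 m.K
      have e2 : (2 : ℝ) ^ m.K * ((m.h * m.b r / 2 ^ m.K : ℚ) : ℝ) = (m.b r : ℝ) * m.x 0 := by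
        simp only [x]; push_cast; field_simp; ring
      rw [e2] at ha
      simpa only [stAt, m.eOf_stInit hr, start] using ha
  | i + 1 => by
      obtain ⟨k1, k2⟩ := mem_eOf_stAt hden hr hr1 hr2 i
      have hs := Encl.mem_dbl hden hr1 m.K
      have e1 : (2 : ℝ) ^ m.K * ((2 * m.h * m.b r / 2 ^ m.K : ℚ) : ℝ) = 2 * m.h * m.b r := by
        push_cast; field_simp
      rw [e1] at hs
      have hrot := Encl.mem_rot k1 k2 hs.1 hs.2
      have e3 : (m.b r : ℝ) * m.x i + 2 * m.h * m.b r = (m.b r : ℝ) * m.x (i + 1) := by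
        simp only [x]; push_cast; ring
      rw [e3] at hrot
      simp only [stAt, m.eOf_stNext' _ hr]
      exact ⟨Encl.mem_roundOut hden hrot.1, Encl.mem_roundOut hden hrot.2⟩

section Tables

variable {e : ℕ → Encl × Encl} {y : ℚ}

/-- `gLoE ≤ g(y)` whenever the supplied pairs enclose `(cos, sin)(b_r y)`. [cite: FitznerVanDerHofstad2016NoBLE,
§5.1.2 (5.11)–(5.16) pp. 1091–1092] -/
theorem gLoE_le (hmem : ∀ r, r < m.R →
      (e r).1.mem (Real.cos ((m.b r : ℝ) * y)) ∧ (e r).2.mem (Real.sin ((m.b r : ℝ) * y))) :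
    (m.gLoE e y : ℝ) ≤ m.g y := by
  simp only [gLoE, g]
  push_cast
  have hs : ∑ r ∈ range m.R, (((e r).1.scale (m.a r)).lo : ℝ) ≤
      ∑ r ∈ range m.R, (m.a r : ℝ) * Real.cos ((m.b r : ℝ) * y) := by
    refine Finset.sum_le_sum fun r hr => ?_
    exact (Encl.mem_scale (hmem r (mem_range.1 hr)).1 (m.a r)).1
  linarith

/-- `dLoE ≤ g'(y) - 1` whenever the supplied pairs enclose `(cos, sin)(b_r y)`. [cite:
FitznerVanDerHofstad2016NoBLE, §5.1.2 (5.11)–(5.16) pp. 1091–1092] -/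
theorem dLoE_le (hmem : ∀ r, r < m.R →
      (e r).1.mem (Real.cos ((m.b r : ℝ) * y)) ∧ (e r).2.mem (Real.sin ((m.b r : ℝ) * y))) :
    (m.dLoE e y : ℝ) ≤ m.g' y - 1 := by
  simp only [dLoE, g']
  push_cast
  have hs : ∑ r ∈ range m.R, (m.a r : ℝ) * m.b r * Real.sin ((m.b r : ℝ) * y) ≤
      ∑ r ∈ range m.R, (((e r).2.scale (m.a r * m.b r)).hi : ℝ) := by
    refine Finset.sum_le_sum fun r hr => ?_
    have := (Encl.mem_scale (hmem r (mem_range.1 hr)).2 (m.a r * m.b r)).2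
    push_cast at this
    linarith
  linarith

/-- `g'(y) - 1 ≤ dHiE` whenever the supplied pairs enclose `(cos, sin)(b_r y)`. [cite:
FitznerVanDerHofstad2016NoBLE, §5.1.2 (5.11)–(5.16) pp. 1091–1092] -/
theorem le_dHiE (hmem : ∀ r, r < m.R →
      (e r).1.mem (Real.cos ((m.b r : ℝ) * y)) ∧ (e r).2.mem (Real.sin ((m.b r : ℝ) * y))) :
    m.g' y - 1 ≤ (m.dHiE e y : ℝ) := by
  simp only [dHiE, g']
  push_cast
  have hs : ∑ r ∈ range m.R, (((e r).2.scale (m.a r * m.b r)).lo : ℝ) ≤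
      ∑ r ∈ range m.R, (m.a r : ℝ) * m.b r * Real.sin ((m.b r : ℝ) * y) := by
    refine Finset.sum_le_sum fun r hr => ?_
    have := (Encl.mem_scale (hmem r (mem_range.1 hr)).2 (m.a r * m.b r)).1
    push_cast at this
    linarith
  linarith

/-- `|g'(y) - 1| ≤ dAbsE` whenever the supplied pairs enclose `(cos, sin)(b_r y)`. [cite:
FitznerVanDerHofstad2016NoBLE, §5.1.2 (5.11)–(5.16) pp. 1091–1092] -/
theorem abs_le_dAbsE (hmem : ∀ r, r < m.R →
      (e r).1.mem (Real.cos ((m.b r : ℝ) * y)) ∧ (e r).2.mem (Real.sin ((m.b r : ℝ) * y))) :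
    |m.g' y - 1| ≤ (m.dAbsE e y : ℝ) := by
  have h1 := m.dLoE_le hmem
  have h2 := m.le_dHiE hmem
  simp only [dAbsE]
  push_cast
  exact abs_le_max_abs_abs h1 h2

end Tables

/-- SOUNDNESS of the kernel check: `check = true` yields the positivity of `N`, the curvature bound
`M2 ≤ M2up`, and — for every cell `i < N` — the enclosure facts `gLo i ≤ g(xᵢ)`, `|g'(xᵢ) - 1| ≤ dAbs i` and
the cell inequality `0 ≤ gLo i - xᵢ - h (dAbs i + M2up h)`, all as real inequalities (exactly the hypotheses of
`SrwTrigMajorantCells.abs_le_of_cellCheck`, up to unfolding `g`, `g'`, `M2`).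
[cite: FitznerVanDerHofstad2016NoBLE, §5.1.2 (5.11)–(5.16) pp. 1091–1092] -/
theorem sound (hc : m.check = true) :
    0 < m.N ∧ (m.M2 : ℝ) ≤ m.M2up ∧
    (∀ i : Fin m.N, (m.gLo i : ℝ) ≤ m.g (m.x i)) ∧
    (∀ i : Fin m.N, |m.g' (m.x i) - 1| ≤ (m.dAbs i : ℝ)) ∧
    (∀ i : Fin m.N, 0 ≤ (m.gLo i : ℝ) - m.x i - m.h * (m.dAbs i + m.M2up * m.h)) := by
  simp only [check, Bool.and_eq_true, decide_eq_true_eq, List.all_eq_true, List.mem_range] at hc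
  obtain ⟨⟨⟨⟨hN, hden⟩, hM⟩, hang⟩, hloop⟩ := hc
  have hmem : ∀ i : ℕ, ∀ r, r < m.R →
      (eOf (m.stAt i) r).1.mem (Real.cos ((m.b r : ℝ) * m.x i)) ∧
        (eOf (m.stAt i) r).2.mem (Real.sin ((m.b r : ℝ) * m.x i)) :=
    fun i r hr => m.mem_eOf_stAt hden hr (hang r hr).1 (hang r hr).2 i
  have hcell : ∀ i : Fin m.N, m.cellOK (eOf (m.stAt i)) (m.x i) = true := fun i => by
    have := m.loop_sound m.N 0 hloop i i.2
    simpa using this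
  refine ⟨hN, by exact_mod_cast hM, fun i => m.gLoE_le (hmem i), fun i => m.abs_le_dAbsE (hmem i),
    fun i => ?_⟩
  have := hcell i
  simp only [cellOK, decide_eq_true_eq] at this
  simp only [gLo, dAbs]
  exact_mod_cast this

/-! ### Part B — one kernel-decided instance

The global coefficient set of the K/U separable-majorant device (CONSTANTS block `carver-g43`, `t`-scale):
`g(t) = B + c t² + Σ_{r<6} a_r cos(b_r t)` with the literal rationals below, `N = 250` cells, `K = 16` angle
doublings, outward-rounding grid `10⁻²⁸`, curvature bound `M2up = 81/5 ≥ M2 = 2|c| + Σ |a_r| b_r² = 16.158`.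
The kernel decides `gset.check = true` (the interval orbit is started from brackets of width `~10⁻²¹`, so
that the wrapping growth `(|cos θ| + |sin θ|)^i` of the angle-addition recurrence leaves final widths
`≤ 2·10⁻⁷`, below the worst cell margin `3.37·10⁻⁵` at cell `i = 20`; exact-rational pre-check by the
companion emulator).  No external quantity is enclosed: `gset_sound` is a closed set of real inequalities
between explicit elementary functions, obtained from Mathlib's `Real.cos_bound` / `Real.sin_bound` and
decided by the kernel; it is the input of the (separate) composition with `abs_le_of_cellCheck`. -/

/-- The global coefficient set of the K/U separable-majorant device on the `t`-scale (literal rationals: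
`B = 0.2117307`, `c = 0.796`, `a = (-0.12444, -0.02926, -0.01197, -0.00599, -0.00307, -0.00169)`,
`b = (5, 10, 15, 20, 25, 30)`), with `N = 250`, `K = 16`, `den = 10^28`, `M2up = 81/5`.
[cite: FitznerVanDerHofstad2016NoBLE, §5.1.2 (5.11)–(5.16) pp. 1091–1092] -/
def gset : MajCert where
  R := 6
  B := (2117307 : ℚ) / 10000000
  c := (199 : ℚ) / 250
  a := fun r => match r with
    | 0 => -(3111 : ℚ) / 25000 | 1 => -(1463 : ℚ) / 50000 | 2 => -(1197 : ℚ) / 100000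
    | 3 => -(599 : ℚ) / 100000 | 4 => -(307 : ℚ) / 100000 | 5 => -(169 : ℚ) / 100000 | _ => 0
  b := fun r => match r with
    | 0 => 5 | 1 => 10 | 2 => 15 | 3 => 20 | 4 => 25 | 5 => 30 | _ => 0
  N := 250
  K := 16
  den := 10 ^ 28
  M2up := (81 : ℚ) / 5

set_option maxHeartbeats 4000000 in
set_option maxRecDepth 100000 in
/-- The kernel decision of the cell check of `gset` (kernel time ≈ 45 s on the check farm; exact-rational
pre-check by the companion emulator).
[cite: FitznerVanDerHofstad2016NoBLE, §5.1.2 (5.11)–(5.16) pp. 1091–1092] -/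
theorem gset_check : gset.check = true := by decide +kernel

/-- The certified facts for `gset`: `0 < N`, `M2 ≤ M2up`, and for every cell `i < 250` the enclosures
`gLo i ≤ g(xᵢ)`, `|g'(xᵢ) - 1| ≤ dAbs i` and the cell inequality — the hypotheses of
`SrwTrigMajorantCells.abs_le_of_cellCheck` for this majorant.
[cite: FitznerVanDerHofstad2016NoBLE, §5.1.2 (5.11)–(5.16) pp. 1091–1092] -/
theorem gset_sound :
    0 < gset.N ∧ (gset.M2 : ℝ) ≤ gset.M2up ∧
    (∀ i : Fin gset.N, (gset.gLo i : ℝ) ≤ gset.g (gset.x i)) ∧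
    (∀ i : Fin gset.N, |gset.g' (gset.x i) - 1| ≤ (gset.dAbs i : ℝ)) ∧
    (∀ i : Fin gset.N, 0 ≤ (gset.gLo i : ℝ) - gset.x i - gset.h * (gset.dAbs i + gset.M2up * gset.h)) :=
  gset.sound gset_check

end MajCert

end Literature.Probability.FitznerVanDerHofstad2017.TrigEncl
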